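import Summits.BirchSwinnertonDyer.BirchSwinnertonDyer.Theorems.RamifiedHeegnerPairLeafRankOneUpperAtThreeShimuraInertTwoCarriers
import Summits.BirchSwinnertonDyer.BirchSwinnertonDyer.Theorems.RamifiedHeegnerPairTwistUnitAdditive
import Summits.BirchSwinnertonDyer.BirchSwinnertonDyer.Theorems.ClassRecordThreeEulerHalvesAtThreeHybridInertSavingServable
import Summits.BirchSwinnertonDyer.Rank1Residual.X9.PrintCertBridge
import Literature.NumberTheory.QuadraticFields.ImaginaryQuadraticPrescribedSplittingInert
import Literature.NumberTheory.EllipticCurves.BSDpVariableChangeProofs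
import HarnessLib

/-!
# U₁ at the two-SPLIT-carrier Gss2 classes (the Shimura rows) — kernel instances of the inert-carrier road, TU|inert

Seat `bsd-trib-w-rhp` g14 (TRIBUNAL-W / kit planner) for route `RamifiedHeegnerPair`; helper file `--supports` the crux U₁ `LeafRankOneUpperAtThree`
(stmt-BirchSwinnertonDyer-26022).  **HONEST FRAMING: theorems only; per-curve certificates under DISPLAYED inputs (conductor, analytic rank, `3 ∤ c(Dt)`, the twist `L`-value, `#Ш(Wd)_an`) and the six
printed facts of the road as hypotheses; nothing is booked, no item is closed; U₁ (26022) / TU|inert / the Shimura-curve Gross–Zagier–Kolyvagin inputs stay research-level and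
OPEN class-wide; BSD is NOT proved for any curve by this file.**

## What
rhp-p2 g10's INERT-CARRIER (Shimura-curve) road proves U₁ at a leaf curve `W` whose Tamagawa-`3` carriers are SPLIT multiplicative primes, by putting them
into the inert set `S` of a Jetchev–Skinner–Wan field `K` (carriers inert ⇒ the twist loses the `3` in `c`; the remaining primes of `N` split), from six printed
facts (`hGZK hmod hnf hJL hCO hHK`: GZK, modularity, newforms, Jacquet–Langlands, Pasten–Shimura 2024 §6 component orders `hCO`, the Shimura-curve Heegner point with
Gross–Zagier–Kolyvagin `hHK`), `Addv ∧ SubGss` at `3`, `3 ∤ c(Dt)`, the SHAPE `3 ∣ c_q ⇒ q split`, (DEG), and ONE field datum with a twist unit (TU|inert: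
`L(W^{(d_K)},1) ≠ 0`, `ord₃ #Ш(W^{(d_K)})_an ≤ 0`).  Its quotable two-carrier form is p657297 `LeafShimuraInert.leafRankOneUpper_three_of_twoCarriers_of_twistUnit`
(`S = {q₁, q₂}`, (DEG) by Papikian–Rabinoff at an odd `q₂ ≢ 1 (mod 3)`); the general form p654714 `…_of_shimuraInertDatum_of_twistUnit` serves the rows
`S = {2, q}`, `q ≡ 1 (mod 3)` through Pasten–Shimura's two-outside-primes clause.  On the rank-one Gss2 census (`N < 5·10⁵`, 355 classes) the classes whose
carriers are exactly two split multiplicative primes number 129; 104 of them have an odd carrier `≢ 1 (mod 3)` and 12 more have two outside multiplicative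
primes one of which has `3 ∤ ord Δ` — the 116 classes instantiated in this file and its continuations `…TwistUnitInert*` (the 7 rows needing Pasten's
`q = 2` cokernel clause and the 6 rows with both carriers `≡ 1 (mod 3)` are out of reach of (DEG) as typed):
* §0 generic kernel lemmas (`mem_of_prime_dvd_prodPow`, `dvd_minimalDiscriminantInt_of_mult`, `not_three_dvd_localTamagawaNumber_of_not_dvd`) and two DOORS
  `leafRankOneUpper_three_of_twoCarriers_of_sqrtField` / `leafRankOneUpper_three_of_twoInert_twoOutside_of_sqrtField`: the instrument's field data at
  `K = ℚ(√D)` from congruences on `D` (inert: `(D/q) = −1`, or `q = 2` and `D ≡ 5 (mod 8)`; split: `(D/ℓ) = +1`, `D ≡ 1 (mod 8)` at `2`) and the `hTU` clause for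
  EVERY minimal model of the twist from ONE (`shaAn` model-independence);
* per curve (`§1, §2, …`, all in the continuation parts `…TwistUnitInertB, C, …`; this part one carries §0 only): `subGss_three_<label>` (Addv ∧ SubGss at `3` IN THE KERNEL via `V = E^{(-3)}_min`, `#Ṽ(𝔽₃)`), `Δ_eq_/c₄_eq_/krausList_<label>`
  (the integer model's `Δ`, `c₄` and prime support IN THE KERNEL), Kraus minimality of `V` and of the twist model `Wd`, and
  `u1_at_<label> : … → MissingUpperBoundAt W 3` whose proof discharges IN THE KERNEL: the two nodal-root split certificates, `hothers` (every prime of `Δ_min`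
  enumerated: additive ⇒ not multiplicative; multiplicative with `3 ∤ ord`; non-split by a no-root certificate), `hshape` (`c_q = 1` off `Δ_min`; Kodaira–Néron
  `Koly.split_and_three_dvd_of_mult_of_three_dvd_localTamagawaNumber` at multiplicative primes; Tate certificates `TamZ`/`TamLocal`/`TamX` giving `c_q ∈ {1,2,4}` at the
  additive primes), the Jacobi/congruence conditions of the field, and the twist identity `Cd • E^{(D)} = Wd`; + `bsd3_at_<label> : … → BSDp W 3` (lower half free:
  `3 ∤ #Ш(E)_an` on every row).
Other roads reach `BSDp` at some of these curves under OTHER displayed inputs (X4 3-descent records, Kolyvagin-index records); nothing of theirs is restated.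

## Data (kit j317417, Sage 10.x + PARI; census `Cruxes/RamifiedPairUpperBound/TU-INERT-CENSUS.md`)
Per class (Cremona optimal curve): `D` = the least negative odd fundamental discriminant with `q₁`, `q₂` inert and every other `ℓ ∣ N` split such that
`L(E^{(D)},1) ≠ 0` and `ord₃ #Ш(E^{(D)})_an = 0`, where `#Ш_an = (L/Ω)·T²/∏c` with Sage's EXACT `L_ratio` on the minimal twist `Wd` (root number `+1`; all 116
values are perfect squares prime to `3`; `|D| ≤ 1487`); models / changes / Kraus lists / local tables / nodal roots from the same job; Tate certificates by n1011-p03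
`tools/tamcert.py` unchanged.  Every numeral that enters a statement is re-checked by the kernel except the DISPLAYED ones (`hN hr Dt hc hLt hqd hvd`).
[cite: JetchevSkinnerWan2017, §7.4.2 (p. 31), Thm. 4.4.1 (p. 19)] [cite: PastenShimura2024, Prop. 6.13, Lemma 6.16, Lemma 6.18 (pp. 23–24)]
[cite: PapikianRabinoff2016, Cor. 3.5] [cite: SilvermanAEC2009, VII.5 Prop. 5.1] [cite: SilvermanATAEC1994, IV.9.4] [cite: Tate1975, §7] [cite: Kraus1989, Prop. 1]
[cite: Marcus2018, Ch. 3 Thm. 25] [cite: Miller2011LMS, Def. 1.1] [cite: Cremona2006, Table 1]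
-/

set_option linter.dupNamespace false
set_option autoImplicit false

noncomputable section

open scoped Classical NumberField

open WeierstrassCurve NumberField IsDedekindDomain IsDedekindDomain.HeightOneSpectrum Rat.HeightOneSpectrum Field Literature Literature.NumberTheory.DiophantineGeometry
  Literature.NumberTheory.EllipticCurves Literature.NumberTheory.EllipticCurves.ModularForms Literature.NumberTheory.EllipticCurves.Rank1Residual
  Literature.NumberTheory.EllipticCurves.Rank1Residual.Typed Literature.NumberTheory.Automorphic Literature.NumberTheory.EllipticCurves.Rank1Residual.X11RankOneCertificates
  Literature.NumberTheory.EllipticCurves.KrizLi2019 Literature.NumberTheory.GaloisRepresentations Literature.NumberTheory.QuadraticFields Literature.NumberTheory.QuadraticFields.Quadratic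
  Summit.BirchSwinnertonDyer.BirchSwinnertonDyer.Rank1Residual Summit.BirchSwinnertonDyer.BirchSwinnertonDyer.Rank1Residual.IntModel
  Summit.BirchSwinnertonDyer.BirchSwinnertonDyer.Rank2Observatory.Tam Summit.BirchSwinnertonDyer.Rank1Residual Summit.BirchSwinnertonDyer.Rank1Residual.Additive
  Summit.BirchSwinnertonDyer.Rank1Residual.X11b Summit.BirchSwinnertonDyer.Rank1Residual.X11b.Three Summit.BirchSwinnertonDyer.Rank1Residual.X9 Summit.BirchSwinnertonDyer.Rank1Residual.GaloisImage
  Summit.BirchSwinnertonDyer.Rank1Residual.Supersingular Summit.BirchSwinnertonDyer.BirchSwinnertonDyer.Theses.RamifiedHeegnerPair Summit.BirchSwinnertonDyer.BirchSwinnertonDyer.Theorems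
  Summit.BirchSwinnertonDyer.BirchSwinnertonDyer.Theorems.SchneiderFree Summit.BirchSwinnertonDyer.BirchSwinnertonDyer.Theorems.RamifiedPairUpperBound
  Summit.BirchSwinnertonDyer.BirchSwinnertonDyer.Theorems.RamifiedHeegnerPairStepLIntrinsic Summit.BirchSwinnertonDyer.BirchSwinnertonDyer.Theorems.AdditiveBranchIMCGordTwoRankOne.HeegnerKolyvagin
  Summit.BirchSwinnertonDyer.BirchSwinnertonDyer.Theorems.RamifiedHeegnerPairTwistUnitIntrinsic Summit.BirchSwinnertonDyer.BirchSwinnertonDyer.Theorems.RamifiedHeegnerPairTwistUnitAdditive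

namespace Summit.BirchSwinnertonDyer.BirchSwinnertonDyer.Theorems.RamifiedHeegnerPairTwistUnitInert

/-! ## §0 Generic kernel lemmas and the two DOORS at `K = ℚ(√D)` -/

/-- A prime dividing `∏ pᵢ^{eᵢ}` over a list of primes `pᵢ` is one of the `pᵢ`. [folklore] -/
theorem mem_of_prime_dvd_prodPow {ℓ : ℕ} (hℓ : ℓ.Prime) (L : List (ℕ × ℕ)) (hL : ∀ qe ∈ L, qe.1.Prime)
    (h : ℓ ∣ (L.map fun qe => qe.1 ^ qe.2).prod) : ℓ ∈ L.map Prod.fst := by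
  induction L with
  | nil =>
    simp only [List.map_nil, List.prod_nil, Nat.dvd_one] at h
    exact absurd h hℓ.one_lt.ne'
  | cons qe L ih =>
    simp only [List.map_cons, List.prod_cons] at h
    rcases (Nat.Prime.dvd_mul hℓ).mp h with h1 | h1
    · exact List.mem_cons.mpr (Or.inl ((Nat.prime_dvd_prime_iff_eq hℓ (hL qe (by simp))).mp (hℓ.dvd_of_dvd_pow h1)))
    · exact List.mem_cons.mpr (Or.inr (ih (fun qe' h' => hL qe' (by simp [h'])) h1))

/-- A prime dividing an integer `n` with `|n| = ∏ pᵢ^{eᵢ}` (a kernel-checked Kraus list) is one of the `pᵢ`. [folklore] -/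
theorem mem_of_prime_dvd_of_prodPow_eq (L : List (ℕ × ℕ)) {n : ℤ}
    (hL : (∀ qe ∈ L, qe.1.Prime) ∧ (L.map fun qe => qe.1 ^ qe.2).prod = n.natAbs) {ℓ : ℕ} (hℓ : ℓ.Prime) (h : (ℓ : ℤ) ∣ n) :
    ℓ ∈ L.map Prod.fst :=
  mem_of_prime_dvd_prodPow hℓ L hL.1 (by rw [hL.2]; exact Int.natCast_dvd.mp h)

/-- **A multiplicative prime divides `Δ_min`** (else good reduction). [cite: SilvermanAEC2009, VII.5 Prop. 5.1] -/
theorem dvd_minimalDiscriminantInt_of_mult (W : WeierstrassCurve ℚ) [W.IsElliptic] [W.IsGloballyMinimal] (ℓ : ℕ) [Fact ℓ.Prime]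
    (hm : W.HasMultiplicativeReductionAtPrime ℓ) : (ℓ : ℤ) ∣ minimalDiscriminantInt W := by
  by_contra h
  exact WeierstrassCurve.HasMultiplicativeReduction.not_hasGoodReduction (R := ℤ_[ℓ]) hm
    (WeierstrassCurve.hasGoodReductionAtPrime_of_not_dvd _ ℓ h)

/-- **`3 ∤ c_q` at a prime `q ∤ Δ_min`** (good reduction: `c_q = 1`). [cite: SilvermanATAEC1994, IV.9.4 Step 1] -/
theorem not_three_dvd_localTamagawaNumber_of_not_dvd (W : WeierstrassCurve ℚ) [W.IsElliptic] [W.IsGloballyMinimal]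
    (q : ℕ) [Fact q.Prime] (h : ¬ (q : ℤ) ∣ minimalDiscriminantInt W) :
    ¬ 3 ∣ (W.baseChange ℚ_[q]).localTamagawaNumber ℤ_[q] := by
  haveI : (W.baseChange ℚ_[q]).IsElliptic := inferInstanceAs (W.map (algebraMap ℚ ℚ_[q])).IsElliptic
  have hc1 : (W.baseChange ℚ_[q]).localTamagawaNumber ℤ_[q] = 1 := by
    haveI : ((W.baseChange ℚ_[q]).minimal ℤ_[q]).HasGoodReduction ℤ_[q] :=
      WeierstrassCurve.hasGoodReductionAtPrime_of_not_dvd W q h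
    exact localTamagawaNumber_eq_one_of_hasGoodReduction_holds ℤ_[q] _
  rw [hc1]; decide

/-- **DOOR (TU|inert, Papikian–Rabinoff rows): U₁ at a leaf curve from the two-carrier instrument at `K = ℚ(√D)`.**  The field data of rhp-p2 g10's
`LeafShimuraInert.leafRankOneUpper_three_of_twoCarriers_of_twistUnit` (p657297) — `K` imaginary quadratic with odd `d_K`, `q₁, q₂` inert and
unramified, every other `ℓ ∣ N` split — produced IN THE KERNEL from congruences on one odd fundamental `D < 0` (`D ≡ 1 (mod 4)` squarefree, `d_K = D`):
`(D/q₂) = −1`; `(D/q₁) = −1`, or `q₁ = 2` with `D ≡ 5 (mod 8)`; `(D/ℓ) = +1` at the other odd `ℓ ∣ N` and `D ≡ 1 (mod 8)` when `2 ∣ N`, `2 ≠ q₁`;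
and the twist-unit clause `hTU` for EVERY globally minimal model of `W^{(D)}` from ONE of them (`Cd • W^{(D)} = Wd`, `#Ш(Wd)_an = qd`, `ord₃ qd ≤ 0`) by
model-independence of `#Ш_an` (`shaAn_eq_of_smul_eq_of_smul_eq_of_isGloballyMinimal`).  Curve-side inputs (`Addv ∧ SubGss` at `3`, the two split
carriers, `hothers`, `hshape`) and the displayed `hN hr Dt hc hLt` pass through.  CONDITIONAL on the six printed facts; an instance maker, never progress on
the leaf; BSD is NOT proved by this. [cite: JetchevSkinnerWan2017, §7.4.2 (p. 31)] [cite: PastenShimura2024, Prop. 6.13, Lemma 6.18 (pp. 23–24)]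
[cite: PapikianRabinoff2016, Cor. 3.5] [cite: Marcus2018, Ch. 3 Thm. 25] [cite: Miller2011LMS, Def. 1.1] -/
theorem leafRankOneUpper_three_of_twoCarriers_of_sqrtField
    (hGZK : rank_eq_analyticRank_of_analyticRank_le_one) (hmod : hasEntireLFunction_rat)
    (hnf : exists_isNewformOf) (hJL : nonempty_shimuraParametrizationData)
    (hCO : PastenShimura2024_componentOrders)
    (hHK : shimuraCurve_heegnerPoint_grossZagier_kolyvagin)
    (W : WeierstrassCurve ℚ) [W.IsElliptic] [W.IsGloballyMinimal]
    (hadd : Addv W 3) (hsub : SubGss W 3) (hr : W.analyticRank = 1)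
    {N : ℕ} [NeZero N] (hN : W.conductorNorm ℤ = N)
    (Dt : ModularParametrizationData W N) (hc : ¬ (3 : ℤ) ∣ Dt.c)
    {q₁ q₂ : ℕ} [Fact q₁.Prime] [Fact q₂.Prime] (hne : q₁ ≠ q₂)
    (h₁ : W.HasSplitMultiplicativeReductionAtPrime q₁) (h₂ : W.HasSplitMultiplicativeReductionAtPrime q₂)
    (hothers : ∀ (ℓ : ℕ) [Fact ℓ.Prime], ℓ ≠ q₁ → ℓ ≠ q₂ → W.HasSplitMultiplicativeReductionAtPrime ℓ →
      ¬ 3 ∣ padicValInt ℓ W.minimalDiscriminantInt)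
    (hq₂2 : q₂ ≠ 2) (hq₂1 : q₂ % 3 ≠ 1)
    (hshape : ∀ (q : ℕ) [Fact q.Prime], 3 ∣ (W.baseChange ℚ_[q]).localTamagawaNumber ℤ_[q] →
      W.HasSplitMultiplicativeReductionAtPrime q)
    (D : ℤ) [hD : Fact (D < 0)] (hD4 : D % 4 = 1) (hsfN : Squarefree D.natAbs)
    (hi₁ : (q₁ = 2 ∧ D % 8 = 5) ∨ (q₁ ≠ 2 ∧ jacobiSym D q₁ = -1)) (hnd₁ : ¬ (q₁ : ℤ) ∣ D)
    (hi₂ : jacobiSym D q₂ = -1) (hnd₂ : ¬ (q₂ : ℤ) ∣ D)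
    (hjac : ∀ ℓ : ℕ, ℓ.Prime → ℓ ∣ W.conductorNorm ℤ → ℓ ≠ q₁ → ℓ ≠ q₂ → ℓ ≠ 2 → jacobiSym D ℓ = 1)
    (h2 : 2 ∣ W.conductorNorm ℤ → q₁ ≠ 2 → D % 8 = 1)
    (hLt : (W.quadraticTwist (D : ℚ)).entireLFunction 1 ≠ 0)
    (Wd : WeierstrassCurve ℚ) [Wd.IsElliptic] [Wd.IsGloballyMinimal] (Cd : VariableChange ℚ)
    (hWd : Cd • W.quadraticTwist (D : ℚ) = Wd) {qd : ℚ} (hqd : shaAn Wd = (qd : ℂ)) (hvd : padicValRat 3 qd ≤ 0) :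
    MissingUpperBoundAt W 3 := by
  have hsf : Squarefree D := Int.squarefree_natAbs.mp hsfN
  obtain ⟨hK, hdisc⟩ := isImaginaryQuadratic_and_discr_sqrtField D hD4 hsf
  have h2K := sqrtField.finrank_eq_two D
  have hodd : Odd (NumberField.discr (sqrtField D)) := by rw [hdisc, Int.odd_iff]; omega
  have hin₂ : ((Ideal.span {(q₂ : ℤ)}).primesOver (𝓞 (sqrtField D))).ncard = 1 ∧ ¬ (q₂ : ℤ) ∣ NumberField.discr (sqrtField D) :=
    ⟨ncard_primesOver_eq_one_of_jacobiSym_eq_neg_one h2K (Fact.out : q₂.Prime) (by rw [hdisc]; exact hi₂), by rw [hdisc]; exact hnd₂⟩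
  have hin₁ : ((Ideal.span {(q₁ : ℤ)}).primesOver (𝓞 (sqrtField D))).ncard = 1 ∧ ¬ (q₁ : ℤ) ∣ NumberField.discr (sqrtField D) := by
    refine ⟨?_, by rw [hdisc]; exact hnd₁⟩
    rcases hi₁ with ⟨h12, h5⟩ | ⟨-, hj⟩
    · subst h12
      have h := ncard_primesOver_two_eq_one_of_discr_mod_eight h2K (by rw [hdisc]; exact h5)
      simpa using h
    · exact ncard_primesOver_eq_one_of_jacobiSym_eq_neg_one h2K (Fact.out : q₁.Prime) (by rw [hdisc]; exact hj)
  have hsplitN : ∀ ℓ : ℕ, ℓ.Prime → ℓ ∣ W.conductorNorm ℤ → ℓ ≠ q₁ → ℓ ≠ q₂ →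
      ((Ideal.span {(ℓ : ℤ)}).primesOver (𝓞 (sqrtField D))).ncard = 2 := by
    intro ℓ hℓ hℓN hne₁ hne₂
    by_cases hℓ2 : ℓ = 2
    · subst hℓ2
      have h := ncard_primesOver_two_sqrtField_eq_two D (h2 hℓN (Ne.symm hne₁)) hsf
      simpa using h
    · exact ncard_primesOver_sqrtField_eq_two_of_jacobiSym D hD4 hsf hℓ hℓ2 (hjac ℓ hℓ hℓN hne₁ hne₂ hℓ2)
  have hLt' : (W.quadraticTwist (NumberField.discr (sqrtField D) : ℚ)).entireLFunction 1 ≠ 0 := by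
    rw [hdisc]; exact hLt
  have hTU : ∀ (Wd' : WeierstrassCurve ℚ) [Wd'.IsElliptic] [Wd'.IsGloballyMinimal] (Cd' : VariableChange ℚ),
      Cd' • W.quadraticTwist (NumberField.discr (sqrtField D) : ℚ) = Wd' →
        ∃ qd : ℚ, shaAn Wd' = (qd : ℂ) ∧ padicValRat 3 qd ≤ 0 := by
    intro Wd' _ _ Cd' hWd'
    rw [hdisc] at hWd'
    exact ⟨qd, (shaAn_eq_of_smul_eq_of_smul_eq_of_isGloballyMinimal hWd hWd').trans hqd, hvd⟩
  exact LeafShimuraInert.leafRankOneUpper_three_of_twoCarriers_of_twistUnit W hGZK hmod hnf hJL hCO hHK hadd hsub hr hN Dt hc hne h₁ h₂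
    hothers hq₂2 hq₂1 hshape (sqrtField D) hK hodd hin₁ hin₂ hsplitN hLt' hTU

/-- **DOOR (TU|inert, two-outside rows): U₁ at a leaf curve whose carriers are `{2, q}` with `q ≡ 1 (mod 3)`, (DEG) by two multiplicative primes
`ℓ₀ ≠ t` outside `S = {q₁, q₂}` with `3 ∤ ord_{ℓ₀} Δ_min` (Pasten–Shimura L6.16), at `K = ℚ(√D)`.**  rhp-p2 g10's general instrument
`LeafShimuraInert.leafRankOneUpper_three_of_shimuraInertDatum_of_twistUnit` (p654714) at `S = {q₁, q₂}` (even; multiplicative; `hFC` from `hothers`),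
second (DEG) disjunct, field data from the `D`-congruences exactly as in `leafRankOneUpper_three_of_twoCarriers_of_sqrtField`.  CONDITIONAL on the six
printed facts; an instance maker; BSD is NOT proved by this. [cite: PastenShimura2024, Prop. 6.13, Lemma 6.16, Lemma 6.18 (pp. 23–24)]
[cite: JetchevSkinnerWan2017, §7.4.2 (p. 31)] [cite: Marcus2018, Ch. 3 Thm. 25] [cite: Miller2011LMS, Def. 1.1] -/
theorem leafRankOneUpper_three_of_twoInert_twoOutside_of_sqrtField
    (hGZK : rank_eq_analyticRank_of_analyticRank_le_one) (hmod : hasEntireLFunction_rat)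
    (hnf : exists_isNewformOf) (hJL : nonempty_shimuraParametrizationData)
    (hCO : PastenShimura2024_componentOrders)
    (hHK : shimuraCurve_heegnerPoint_grossZagier_kolyvagin)
    (W : WeierstrassCurve ℚ) [W.IsElliptic] [W.IsGloballyMinimal]
    (hadd : Addv W 3) (hsub : SubGss W 3) (hr : W.analyticRank = 1)
    {N : ℕ} [NeZero N] (hN : W.conductorNorm ℤ = N)
    (Dt : ModularParametrizationData W N) (hc : ¬ (3 : ℤ) ∣ Dt.c)
    {q₁ q₂ : ℕ} [Fact q₁.Prime] [Fact q₂.Prime] (hne : q₁ ≠ q₂)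
    (h₁ : W.HasSplitMultiplicativeReductionAtPrime q₁) (h₂ : W.HasSplitMultiplicativeReductionAtPrime q₂)
    (hothers : ∀ (ℓ : ℕ) [Fact ℓ.Prime], ℓ ≠ q₁ → ℓ ≠ q₂ → W.HasSplitMultiplicativeReductionAtPrime ℓ →
      ¬ 3 ∣ padicValInt ℓ W.minimalDiscriminantInt)
    (hshape : ∀ (q : ℕ) [Fact q.Prime], 3 ∣ (W.baseChange ℚ_[q]).localTamagawaNumber ℤ_[q] →
      W.HasSplitMultiplicativeReductionAtPrime q)
    (ℓ₀ t : ℕ) [Fact ℓ₀.Prime] [Fact t.Prime] (hℓ₀ : W.HasMultiplicativeReductionAtPrime ℓ₀) (ht : W.HasMultiplicativeReductionAtPrime t)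
    (hℓ₀1 : ℓ₀ ≠ q₁) (hℓ₀2 : ℓ₀ ≠ q₂) (ht1 : t ≠ q₁) (ht2 : t ≠ q₂) (htℓ : t ≠ ℓ₀)
    (hv₀ : ¬ 3 ∣ padicValInt ℓ₀ W.minimalDiscriminantInt)
    (D : ℤ) [hD : Fact (D < 0)] (hD4 : D % 4 = 1) (hsfN : Squarefree D.natAbs)
    (hi₁ : (q₁ = 2 ∧ D % 8 = 5) ∨ (q₁ ≠ 2 ∧ jacobiSym D q₁ = -1)) (hnd₁ : ¬ (q₁ : ℤ) ∣ D)
    (hi₂ : jacobiSym D q₂ = -1) (hnd₂ : ¬ (q₂ : ℤ) ∣ D)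
    (hjac : ∀ ℓ : ℕ, ℓ.Prime → ℓ ∣ W.conductorNorm ℤ → ℓ ≠ q₁ → ℓ ≠ q₂ → ℓ ≠ 2 → jacobiSym D ℓ = 1)
    (h2 : 2 ∣ W.conductorNorm ℤ → q₁ ≠ 2 → D % 8 = 1)
    (hLt : (W.quadraticTwist (D : ℚ)).entireLFunction 1 ≠ 0)
    (Wd : WeierstrassCurve ℚ) [Wd.IsElliptic] [Wd.IsGloballyMinimal] (Cd : VariableChange ℚ)
    (hWd : Cd • W.quadraticTwist (D : ℚ) = Wd) {qd : ℚ} (hqd : shaAn Wd = (qd : ℂ)) (hvd : padicValRat 3 qd ≤ 0) :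
    MissingUpperBoundAt W 3 := by
  have hsf : Squarefree D := Int.squarefree_natAbs.mp hsfN
  obtain ⟨hK, hdisc⟩ := isImaginaryQuadratic_and_discr_sqrtField D hD4 hsf
  have h2K := sqrtField.finrank_eq_two D
  have hodd : Odd (NumberField.discr (sqrtField D)) := by rw [hdisc, Int.odd_iff]; omega
  have hin₂ : ((Ideal.span {(q₂ : ℤ)}).primesOver (𝓞 (sqrtField D))).ncard = 1 ∧ ¬ (q₂ : ℤ) ∣ NumberField.discr (sqrtField D) :=
    ⟨ncard_primesOver_eq_one_of_jacobiSym_eq_neg_one h2K (Fact.out : q₂.Prime) (by rw [hdisc]; exact hi₂), by rw [hdisc]; exact hnd₂⟩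
  have hin₁ : ((Ideal.span {(q₁ : ℤ)}).primesOver (𝓞 (sqrtField D))).ncard = 1 ∧ ¬ (q₁ : ℤ) ∣ NumberField.discr (sqrtField D) := by
    refine ⟨?_, by rw [hdisc]; exact hnd₁⟩
    rcases hi₁ with ⟨h12, h5⟩ | ⟨-, hj⟩
    · subst h12
      have h := ncard_primesOver_two_eq_one_of_discr_mod_eight h2K (by rw [hdisc]; exact h5)
      simpa using h
    · exact ncard_primesOver_eq_one_of_jacobiSym_eq_neg_one h2K (Fact.out : q₁.Prime) (by rw [hdisc]; exact hj)
  have hTU : ∀ (Wd' : WeierstrassCurve ℚ) [Wd'.IsElliptic] [Wd'.IsGloballyMinimal] (Cd' : VariableChange ℚ),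
      Cd' • W.quadraticTwist (NumberField.discr (sqrtField D) : ℚ) = Wd' →
        ∃ qd : ℚ, shaAn Wd' = (qd : ℂ) ∧ padicValRat 3 qd ≤ 0 := by
    intro Wd' _ _ Cd' hWd'
    rw [hdisc] at hWd'
    exact ⟨qd, (shaAn_eq_of_smul_eq_of_smul_eq_of_isGloballyMinimal hWd hWd').trans hqd, hvd⟩
  have hq₁S : ∀ {ℓ : ℕ}, ℓ ∉ ({q₁, q₂} : Finset ℕ) → ℓ ≠ q₁ := fun h h' ↦ h (by simp [h'])
  have hq₂S : ∀ {ℓ : ℕ}, ℓ ∉ ({q₁, q₂} : Finset ℕ) → ℓ ≠ q₂ := fun h h' ↦ h (by simp [h'])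
  have hnotin : ∀ {ℓ : ℕ}, ℓ ≠ q₁ → ℓ ≠ q₂ → ℓ ∉ ({q₁, q₂} : Finset ℕ) := fun h h' hm ↦ by
    rcases Finset.mem_insert.mp hm with rfl | hm
    · exact h rfl
    · exact h' (Finset.mem_singleton.mp hm)
  refine LeafShimuraInert.leafRankOneUpper_three_of_shimuraInertDatum_of_twistUnit hGZK hmod hnf hJL hCO hHK W hadd hsub hr hN Dt hc {q₁, q₂}
    ?_ ?_ (fun ℓ _ hℓ hs ↦ hothers ℓ (hq₁S hℓ) (hq₂S hℓ) hs) hshape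
    (Or.inr (Or.inl ⟨ℓ₀, t, ‹_›, ‹_›, hℓ₀, ht, hnotin hℓ₀1 hℓ₀2, hnotin ht1 ht2, htℓ, hv₀⟩))
    (sqrtField D) hK hodd ?_ (fun ℓ hℓ hℓN hℓS ↦ ?_) (by rw [hdisc]; exact hLt) hTU
  · rw [Finset.card_insert_of_notMem (by simpa using hne), Finset.card_singleton]; decide
  · intro ℓ hℓ
    rcases Finset.mem_insert.mp hℓ with rfl | hℓ
    · exact ⟨inferInstance, h₁.hasMultiplicativeReductionAtPrime⟩
    · rw [Finset.mem_singleton] at hℓ; subst hℓ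
      exact ⟨inferInstance, h₂.hasMultiplicativeReductionAtPrime⟩
  · intro ℓ hℓ
    rcases Finset.mem_insert.mp hℓ with rfl | hℓ
    · exact hin₁
    · rw [Finset.mem_singleton] at hℓ; subst hℓ
      exact hin₂
  · by_cases hℓ2 : ℓ = 2
    · subst hℓ2
      have h := ncard_primesOver_two_sqrtField_eq_two D (h2 hℓN (Ne.symm (hq₁S hℓS))) hsf
      simpa using h
    · exact ncard_primesOver_sqrtField_eq_two_of_jacobiSym D hD4 hsf hℓ hℓ2 (hjac ℓ hℓ hℓN (hq₁S hℓS) (hq₂S hℓS) hℓ2)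

/-- **BSD₃ from U₁ and a displayed `3`-adic unit `#Ш_an`** (rank one): the LOWER half `ord₃ q ≤ 0 ≤ ord₃ #Ш` is free, and GZK glues
(`Typed.missingPPartAt_of_lower_of_upper`, `Typed.bsdp_of_missingPPartAt`).  So every `u1_at_<label>` below gives `BSDp W 3` in one line from the
displayed `#Ш(E)_an` (a `3`-adic unit on all rows); CONDITIONAL on the displayed inputs; BSD is NOT proved by this. [cite: Miller2011LMS, Def. 1.1] -/
theorem bsdp_three_of_upper_of_shaAn_unit (hGZK : rank_eq_analyticRank_of_analyticRank_le_one)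
    (W : WeierstrassCurve ℚ) [W.IsElliptic] (hr : W.analyticRank = 1) (hup : MissingUpperBoundAt W 3)
    {q : ℚ} (hq : shaAn W = (q : ℂ)) (hv : padicValRat 3 q ≤ 0) : BSDp W 3 :=
  Typed.bsdp_of_missingPPartAt _ 3 hGZK hr.le
    (Typed.missingPPartAt_of_lower_of_upper _ 3 ⟨q, hq, hv.trans (by exact_mod_cast Nat.zero_le _)⟩ hup)

end Summit.BirchSwinnertonDyer.BirchSwinnertonDyer.Theorems.RamifiedHeegnerPairTwistUnitInert

end
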